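import Mathlib
import HarnessLib
import Summits.PneNP.PneNP.Theorems.CnfIdealGenLengthRankStability
import Summits.PneNP.PneNP.Theorems.CnfIdealGenLengthRankDefectRepresentationsQuadraticWitness
import Summits.PneNP.PneNP.Theorems.CnfIdealGenLengthRankDefectRepresentationsTautologyQuadratic

/-!
# Crux `RankDefectRepresentations` (stmt-PneNP-18923), line `rank-dehn-ladder`: the calibration stub `stub_linearInstability`

The known LINEAR floor of rung 1 (`SuperlinearInstability`) as a theorem: for every `n ≥ 1` there are a field of
characteristic `0` and a `t`-almost-representation `M` of the Boolean/commutator presentation (`t ≤ C`, here `C = 8`)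
at coordinatewise rank-distance `≥ n / C − 1` from EVERY genuine representation (pairwise commuting idempotents):
`n ≤ C · (rank (M_i − M'_i) + 1)` for some `i`.

Proof: the quadratic witness of `stub_quadraticWitness` (p581240: pair blocks, `t ≤ 4`,
`n² ≤ 4 (rank P_{φ_n}(M) + n)` for the calibration CNF `φ_n = {x_0},…,{x_{n−1}},{¬x_0 ∨ … ∨ ¬x_{n−1}}` of size
`2n`) combined with the telescoping bound `rank P_φ(M) ≤ size(φ) · max_i rank (M_i − M'_i)` at a genuine `M'`
(`rank_eval_clauseProduct_le_size_mul`, p542939; `φ_n` is unsatisfiable, `not_satisfiable_calib`), so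
`n² ≤ 4 (2nD + n)`, i.e. `n ≤ 8D + 4`.

This is the registered calibration stub of the skeleton `Cruxes/RankDefectRepresentations/Lines/rank_dehn_ladder.lean`
(lead g5 reshape); it records that the stability modulus `f(n)` of `n` commuting idempotents in the rank metric satisfies
`f(n) ≥ n/8 − O(1)` (rung 1 asks for `f(n)/n → ∞`, rung 2 for `f` superpolynomial; the crux is refuted if `f` is
polynomial). HONEST FRAMING: elementary; P ≠ NP is not moved; F-N2 is a FRONTIER formal rung.
-/

set_option linter.dupNamespace false -- `Summit.PneNP.PneNP.…`: summit = sub-problem name (D-0017)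

namespace Summit.PneNP.PneNP.Theorems.CnfIdealGenLengthRankDefectRepresentationsLinearInstability

open Filter
open Literature.Computability.Complexity
open Literature.Computability.MetaComplexity
open Literature.Computability.MetaComplexity.NCIPS
open Summit.PneNP.PneNP.Theorems.CnfIdealGenLength (rank_eval_clauseProduct_le_size_mul)
open Summit.PneNP.PneNP.Theorems.CnfIdealGenLengthRankDefectRepresentationsQuadraticWitness (stub_quadraticWitness)
open Summit.PneNP.PneNP.Theorems.CnfIdealGenLengthRankDefectRepresentationsTautologyQuadratic
  (not_satisfiable_calib size_calib)

/-- **Linear instability (calibration rung of line `rank-dehn-ladder`, registered stub `stub_linearInstability`).**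
There is a constant `C` (here `8`) such that for every `n ≥ 1` some `t`-almost-representation with `t ≤ C` over a
field of characteristic `0` is at coordinatewise rank-distance `D` with `n ≤ C (D + 1)` from every tuple of pairwise
commuting idempotent matrices. [folklore] -/
theorem stub_linearInstability :
    ∃ C : ℕ, ∀ n : ℕ, 0 < n → ∃ (K : Type) (_ : Field K) (_ : CharZero K) (d t : ℕ)
      (M : Fin n → Matrix (Fin d) (Fin d) K),
      (∀ g : MonoidAlgebra K (FreeMonoid (Fin n)), IsAxiom g →
        (MonoidAlgebra.lift K (Matrix (Fin d) (Fin d) K) (FreeMonoid (Fin n)) (FreeMonoid.lift M) g).rank ≤ t) ∧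
      t ≤ C ∧
      ∀ M' : Fin n → Matrix (Fin d) (Fin d) K, ((∀ i, M' i * M' i = M' i) ∧ ∀ i j, M' i * M' j = M' j * M' i) →
        ∃ i, n ≤ C * ((M i - M' i).rank + 1) := by
  obtain ⟨C₀, hC₀⟩ := stub_quadraticWitness
  refine ⟨2 * C₀, fun n hn => ?_⟩
  obtain ⟨K, iF, iC, d, t, M, hax, ht, hP⟩ := hC₀ n
  refine ⟨K, iF, iC, d, t, M, hax, by omega, fun M' hM' => ?_⟩
  classical
  have hne : (Finset.univ : Finset (Fin n)).Nonempty := Finset.univ_nonempty_iff.mpr ⟨⟨0, hn⟩⟩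
  obtain ⟨i, -, hi⟩ := Finset.exists_max_image Finset.univ (fun i => (M i - M' i).rank) hne
  refine ⟨i, ?_⟩
  set D := (M i - M' i).rank with hDdef
  have hD : ∀ j, (M j - M' j).rank ≤ D := fun j => hi j (Finset.mem_univ j)
  have hrank := rank_eval_clauseProduct_le_size_mul M M' hM'.1 hM'.2 (not_satisfiable_calib n) hD
  rw [(size_calib n).1] at hrank
  have h1 : n * n ≤ C₀ * (2 * n * D + n) :=
    hP.trans (Nat.mul_le_mul_left _ (Nat.add_le_add_right hrank n))
  have h2 : n * n ≤ n * (C₀ * (2 * D + 1)) := by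
    have : C₀ * (2 * n * D + n) = n * (C₀ * (2 * D + 1)) := by ring
    rw [this] at h1; exact h1
  have h3 : n ≤ C₀ * (2 * D + 1) := Nat.le_of_mul_le_mul_left h2 hn
  nlinarith

end Summit.PneNP.PneNP.Theorems.CnfIdealGenLengthRankDefectRepresentationsLinearInstability
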